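import Mathlib.Analysis.SpecialFunctions.Integrals.Basic
import Mathlib.Analysis.SpecialFunctions.Trigonometric.Bounds
import Mathlib.Analysis.Complex.Exponential
import Literature.Geometry.ComplexHyperbolic.UnitBallLieAlgebraOrbitalDefs   -- ★ p846448 (a0): `torusH`
import Literature.Geometry.ComplexHyperbolic.UnitBallBounds                   -- ★ `mat_mul`, `mat_one` (U21 API)
import HarnessLib

/-!
# The GROUP → ALGEBRA transfer, analytic step: `‖Ad(g)·e^{H}‖ ≤ R ⟹ ‖Ad(g)·H‖ ≤ C(R)` on the torus of `𝔲(2,1)` by Newton interpolation (ROAD «A6-IV» brick (a2-A))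

Topic `Geometry/ComplexHyperbolic`; namespace `Literature.Geometry.ComplexHyperbolic.BallModel`.  THEOREMS ONLY (no `def`, no instance, no notation, no axiom, no named fact, no `sorry`).
Cell `pub/hodgecm-mathlib`, ENGINE T1 (crux H413 = `stmt-HodgeConjecture-24833`); ROAD «A6-IV» (owner∕architect F0P3a-p05 (g15), DESIGN v2 93542b84b04a2b0a; SPEC fb65bd65775896a0 §(a2) first bullet
`norm_conj_le_of_norm_exp_conj_le`); census F0P3a-p01 (g15) 19:05:54Z; pen F0P3a-p02 (g14), 2026-09-01.

THE MATHEMATICS.  Let `g ∈ U(2,1)`, `θ ∈ ℝ³` with `|θ_k| ≤ 1∕4`, `H = torusH θ = diag(iθ_k)`, `z_k = e^{iθ_k}`, `X = Ad(g)H = g·diag(iθ)·g⁻¹`, `Y = Ad(g)e^{H} = g·diag(z)·g⁻¹`.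
`X` and `Y` are SIMULTANEOUSLY diagonalised by `g`, so `X = p(Y)` for every polynomial `p` with `p(z_k) = iθ_k` (multiplicities are irrelevant).  §1: the divided differences of `t ↦ e^{it}` on an
arc of length `≤ 1∕2` have modulus `≥ 1∕2` (`Complex.norm_exp_sub_one_sub_id_le`) and are `1`-Lipschitz in one node (they are `∫₀¹ e^{itu} dt`: `integral_exp_mul_complex`,
`Real.norm_exp_I_mul_ofReal_sub_one_le`).  §2: hence a Newton form `p(y) = iθ₀ + c₁(y − z₀) + c₂(y − z₀)(y − z₁)` exists with `|c₁| ≤ 2`, `|c₂| ≤ 8` (cases on the coincidences among the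
`θ_k`).  §3: `X = iθ₀·1 + c₁(Y − z₀) + c₂(Y − z₀)(Y − z₁)` and **`‖X‖ ≤ 1∕4 + 2(R + 1) + 8(R + 1)²` whenever `‖Y‖ ≤ R`** (`L^∞` operator norm) — the only non-algebraic input of the transfer
`Φ_Θ(ζe^{iθ}) = lieOrbital μ f (torusH θ)` of (a2): it makes the set `{Ad(u)·torusH θ : |θ_k| ≤ 1∕4, Θ(ζ·Ad(u)e^{torusH θ}) ≠ 0}` BOUNDED, so that a fixed ambient cutoff `ψ₀` turns
`Θ(ζ·exp ·)` into a compactly supported `f` without changing the orbital integral.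
HONEST LABEL: HC_CM is proved only modulo the printed citations until rung 0 closes; elementary analysis, pays nothing by itself.

* [WarnerHASSLG2] G. Warner, *Harmonic Analysis on Semi-Simple Lie Groups II* (1972), §8.4.1 (passage between the invariant integral on `G` near a semisimple point and on `𝔤` via `exp`).
* [Rudin1976] W. Rudin, *Principles of Mathematical Analysis*, 3rd ed. (1976), Thm. 6.25 ∕ 8.7 (integral bounds; the exponential series).
-/

noncomputable section

open Matrix Complex MeasureTheory Set intervalIntegral

open scoped Matrix.Norms.Operator

namespace Literature.Geometry.ComplexHyperbolic

namespace BallModel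

/-! ### §1 Divided differences of `t ↦ e^{it}` on a short arc -/

section Arc

/-- `e^{ib} − e^{ia} = e^{ia}(e^{i(b−a)} − 1)`. [cite: Rudin1976, Thm. 8.7] -/
theorem cexp_mul_I_sub_cexp_mul_I (a b : ℝ) :
    cexp ((b : ℂ) * I) - cexp ((a : ℂ) * I) = cexp ((a : ℂ) * I) * (cexp (((b - a : ℝ) : ℂ) * I) - 1) := by
  rw [mul_sub_one, ← Complex.exp_add]
  push_cast
  ring_nf

/-- `e^{i·}` is `1`-Lipschitz: `‖e^{ib} − e^{ia}‖ ≤ |b − a|`. [cite: Rudin1976, Thm. 8.7] -/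
theorem norm_cexp_mul_I_sub_cexp_mul_I_le (a b : ℝ) : ‖cexp ((b : ℂ) * I) - cexp ((a : ℂ) * I)‖ ≤ |b - a| := by
  rw [cexp_mul_I_sub_cexp_mul_I, norm_mul, Complex.norm_exp_ofReal_mul_I, one_mul, mul_comm]
  exact Real.norm_exp_I_mul_ofReal_sub_one_le.trans (le_of_eq (Real.norm_eq_abs _))

/-- **CHORD ≥ HALF ARC on a short arc**: `|u|∕2 ≤ ‖e^{iu} − 1‖` for `|u| ≤ 1∕2` (second-order Taylor bound of `exp`). [cite: Rudin1976, Thm. 8.7] -/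
theorem half_abs_le_norm_cexp_mul_I_sub_one {u : ℝ} (hu : |u| ≤ 1 / 2) : |u| / 2 ≤ ‖cexp ((u : ℂ) * I) - 1‖ := by
  have hn : ‖((u : ℂ) * I)‖ = |u| := by rw [norm_mul, Complex.norm_I, mul_one, Complex.norm_real, Real.norm_eq_abs]
  have h1 : ‖cexp ((u : ℂ) * I) - 1 - (u : ℂ) * I‖ ≤ |u| ^ 2 := by
    have := Complex.norm_exp_sub_one_sub_id_le (x := (u : ℂ) * I) (by rw [hn]; linarith [abs_nonneg u])
    rwa [hn] at this
  have h2 : |u| ≤ ‖cexp ((u : ℂ) * I) - 1‖ + ‖cexp ((u : ℂ) * I) - 1 - (u : ℂ) * I‖ := by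
    have := norm_sub_le (cexp ((u : ℂ) * I) - 1) (cexp ((u : ℂ) * I) - 1 - (u : ℂ) * I)
    rwa [sub_sub_cancel, hn] at this
  nlinarith [abs_nonneg u]

/-- Two-point form: `|b − a|∕2 ≤ ‖e^{ib} − e^{ia}‖` for `|b − a| ≤ 1∕2`; in particular distinct angles give distinct points. [cite: Rudin1976, Thm. 8.7] -/
theorem half_abs_sub_le_norm_cexp_sub_cexp {a b : ℝ} (hab : |b - a| ≤ 1 / 2) :
    |b - a| / 2 ≤ ‖cexp ((b : ℂ) * I) - cexp ((a : ℂ) * I)‖ := by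
  rw [cexp_mul_I_sub_cexp_mul_I, norm_mul, Complex.norm_exp_ofReal_mul_I, one_mul]
  exact half_abs_le_norm_cexp_mul_I_sub_one hab

/-- **THE FIRST DIVIDED DIFFERENCE OF `log` AT TWO CIRCLE POINTS IS `≤ 2`**: `‖i(b−a)∕(e^{ib} − e^{ia})‖ ≤ 2` for `0 < |b − a| ≤ 1∕2`. [cite: Rudin1976, Thm. 8.7] -/
theorem norm_logDividedDiff_le {a b : ℝ} (hne : b ≠ a) (hab : |b - a| ≤ 1 / 2) :
    ‖(((b - a : ℝ) : ℂ) * I) / (cexp ((b : ℂ) * I) - cexp ((a : ℂ) * I))‖ ≤ 2 := by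
  have hpos : 0 < |b - a| := abs_pos.2 (sub_ne_zero.2 hne)
  have hlow := half_abs_sub_le_norm_cexp_sub_cexp hab
  have hden : 0 < ‖cexp ((b : ℂ) * I) - cexp ((a : ℂ) * I)‖ := lt_of_lt_of_le (by linarith) hlow
  rw [norm_div, norm_mul, Complex.norm_I, mul_one, Complex.norm_real, Real.norm_eq_abs, div_le_iff₀ hden]
  linarith

/-- The divided difference of `e^{i·}` as an integral: `(e^{iu} − 1)∕(iu) = ∫₀¹ e^{iut} dt` (`u ≠ 0`). [cite: Rudin1976, Thm. 6.25] -/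
theorem expDividedDiff_eq_integral {u : ℝ} (hu : u ≠ 0) :
    (cexp ((u : ℂ) * I) - 1) / ((u : ℂ) * I) = ∫ t in (0 : ℝ)..1, cexp ((u : ℂ) * I * t) := by
  have hc : (u : ℂ) * I ≠ 0 := mul_ne_zero (Complex.ofReal_ne_zero.2 hu) Complex.I_ne_zero
  rw [integral_exp_mul_complex hc]
  simp

/-- **THE DIVIDED DIFFERENCE OF `e^{i·}` IS `1`-LIPSCHITZ IN THE STEP**: `‖(e^{iu} − 1)∕(iu) − (e^{iv} − 1)∕(iv)‖ ≤ |u − v|` (`u, v ≠ 0`). [cite: Rudin1976, Thm. 6.25] -/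
theorem norm_expDividedDiff_sub_le {u v : ℝ} (hu : u ≠ 0) (hv : v ≠ 0) :
    ‖(cexp ((u : ℂ) * I) - 1) / ((u : ℂ) * I) - (cexp ((v : ℂ) * I) - 1) / ((v : ℂ) * I)‖ ≤ |u - v| := by
  rw [expDividedDiff_eq_integral hu, expDividedDiff_eq_integral hv, ← intervalIntegral.integral_sub (Continuous.intervalIntegrable (by fun_prop) _ _) (Continuous.intervalIntegrable (by fun_prop) _ _)]
  have h := intervalIntegral.norm_integral_le_of_norm_le_const (a := (0 : ℝ)) (b := 1) (C := |u - v|)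
    (f := fun t : ℝ => cexp ((u : ℂ) * I * t) - cexp ((v : ℂ) * I * t)) fun t ht => by
      have ht' : 0 < t ∧ t ≤ 1 := by simpa [Set.uIoc_of_le (zero_le_one : (0 : ℝ) ≤ 1)] using ht
      have e1 : (u : ℂ) * I * t = ((u * t : ℝ) : ℂ) * I := by push_cast; ring
      have e2 : (v : ℂ) * I * t = ((v * t : ℝ) : ℂ) * I := by push_cast; ring
      rw [e1, e2]
      refine (norm_cexp_mul_I_sub_cexp_mul_I_le _ _).trans ?_
      rw [← sub_mul, abs_mul, abs_of_pos ht'.1]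
      exact mul_le_of_le_one_right (abs_nonneg _) ht'.2
  simpa using h

/-- The divided difference of `e^{i·}` has modulus `≥ 1∕2` on a short arc: `1∕2 ≤ ‖(e^{iu} − 1)∕(iu)‖` for `0 < |u| ≤ 1∕2`. [cite: Rudin1976, Thm. 8.7] -/
theorem half_le_norm_expDividedDiff {u : ℝ} (hu : u ≠ 0) (hu' : |u| ≤ 1 / 2) : 1 / 2 ≤ ‖(cexp ((u : ℂ) * I) - 1) / ((u : ℂ) * I)‖ := by
  have hpos : 0 < |u| := abs_pos.2 hu
  rw [norm_div, norm_mul, Complex.norm_I, mul_one, Complex.norm_real, Real.norm_eq_abs, le_div_iff₀ hpos]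
  linarith [half_abs_le_norm_cexp_mul_I_sub_one hu']

/-- **THE INVERSE DIVIDED DIFFERENCES ARE `4`-LIPSCHITZ**: `‖((e^{iu}−1)∕(iu))⁻¹ − ((e^{iv}−1)∕(iv))⁻¹‖ ≤ 4|u − v|` for `0 < |u|, |v| ≤ 1∕2`. [cite: Rudin1976, Thm. 8.7] -/
theorem norm_inv_expDividedDiff_sub_le {u v : ℝ} (hu : u ≠ 0) (hv : v ≠ 0) (hu' : |u| ≤ 1 / 2) (hv' : |v| ≤ 1 / 2) :
    ‖((cexp ((u : ℂ) * I) - 1) / ((u : ℂ) * I))⁻¹ - ((cexp ((v : ℂ) * I) - 1) / ((v : ℂ) * I))⁻¹‖ ≤ 4 * |u - v| := by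
  set A : ℂ := (cexp ((u : ℂ) * I) - 1) / ((u : ℂ) * I) with hA
  set B : ℂ := (cexp ((v : ℂ) * I) - 1) / ((v : ℂ) * I) with hB
  have hA2 : 1 / 2 ≤ ‖A‖ := half_le_norm_expDividedDiff hu hu'
  have hB2 : 1 / 2 ≤ ‖B‖ := half_le_norm_expDividedDiff hv hv'
  have hA0 : A ≠ 0 := fun h => by rw [h, norm_zero] at hA2; linarith
  have hB0 : B ≠ 0 := fun h => by rw [h, norm_zero] at hB2; linarith
  rw [inv_sub_inv hA0 hB0, norm_div, norm_mul, div_le_iff₀ (by positivity)]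
  have hsub : ‖B - A‖ ≤ |u - v| := by rw [norm_sub_rev]; exact norm_expDividedDiff_sub_le hu hv
  nlinarith [norm_nonneg (B - A), mul_le_mul hA2 hB2 (by norm_num) (norm_nonneg A), abs_nonneg (u - v)]

/-- `i(b−a)∕(e^{ib} − e^{ia}) = e^{−ia}·((e^{i(b−a)} − 1)∕(i(b−a)))⁻¹`: the divided difference of `log`-type is the inverse of that of `exp`, up to the phase. [cite: Rudin1976, Thm. 8.7] -/
theorem logDividedDiff_eq (a b : ℝ) (hne : b ≠ a) :
    (((b - a : ℝ) : ℂ) * I) / (cexp ((b : ℂ) * I) - cexp ((a : ℂ) * I)) =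
      (cexp ((a : ℂ) * I))⁻¹ * ((cexp (((b - a : ℝ) : ℂ) * I) - 1) / (((b - a : ℝ) : ℂ) * I))⁻¹ := by
  have hc : ((b - a : ℝ) : ℂ) * I ≠ 0 := mul_ne_zero (Complex.ofReal_ne_zero.2 (sub_ne_zero.2 hne)) Complex.I_ne_zero
  have he : cexp ((a : ℂ) * I) ≠ 0 := Complex.exp_ne_zero _
  rw [cexp_mul_I_sub_cexp_mul_I, inv_div, ← div_div, div_eq_mul_inv, div_eq_mul_inv, div_eq_mul_inv]
  field_simp

/-- **THE SECOND NEWTON COEFFICIENT IS BOUNDED**: `‖i(c−a)∕(e^{ic}−e^{ia}) − i(b−a)∕(e^{ib}−e^{ia})‖ ≤ 4|c − b|` for distinct short-arc nodes. [cite: Rudin1976, Thm. 8.7] -/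
theorem norm_logDividedDiff_sub_le {a b c : ℝ} (hb : b ≠ a) (hc : c ≠ a) (hb' : |b - a| ≤ 1 / 2) (hc' : |c - a| ≤ 1 / 2) :
    ‖(((c - a : ℝ) : ℂ) * I) / (cexp ((c : ℂ) * I) - cexp ((a : ℂ) * I)) - (((b - a : ℝ) : ℂ) * I) / (cexp ((b : ℂ) * I) - cexp ((a : ℂ) * I))‖ ≤
      4 * |c - b| := by
  rw [logDividedDiff_eq a c hc, logDividedDiff_eq a b hb, ← mul_sub, norm_mul, norm_inv, Complex.norm_exp_ofReal_mul_I, inv_one, one_mul]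
  have h := norm_inv_expDividedDiff_sub_le (sub_ne_zero.2 hc) (sub_ne_zero.2 hb) hc' hb'
  rwa [show c - a - (b - a) = c - b by ring] at h

end Arc

/-! ### §2 The Newton coefficients for the data `e^{iθ_k} ↦ iθ_k` -/

section Newton

/-- **NEWTON FORM THROUGH THE (MULTI)SET `{e^{iθ_k}}`**: for `|θ_k| ≤ 1∕4` there are `c₁, c₂` with `|c₁| ≤ 2`, `|c₂| ≤ 8` and
`iθ_k = iθ₀ + c₁(z_k − z₀) + c₂(z_k − z₀)(z_k − z₁)` for all `k`, `z_k = e^{iθ_k}` (cases on the coincidences `θ₁ = θ₀`, `θ₂ ∈ {θ₀, θ₁}`). [cite: Rudin1976, Thm. 8.7] -/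
theorem exists_newton_coeffs (θ : Fin 3 → ℝ) (hθ : ∀ k, |θ k| ≤ 1 / 4) :
    ∃ c₁ c₂ : ℂ, ‖c₁‖ ≤ 2 ∧ ‖c₂‖ ≤ 8 ∧ ∀ k : Fin 3,
      (θ k : ℂ) * I = (θ 0 : ℂ) * I + c₁ * (cexp ((θ k : ℂ) * I) - cexp ((θ 0 : ℂ) * I)) +
        c₂ * ((cexp ((θ k : ℂ) * I) - cexp ((θ 0 : ℂ) * I)) * (cexp ((θ k : ℂ) * I) - cexp ((θ 1 : ℂ) * I))) := by
  have hd : ∀ j k : Fin 3, |θ j - θ k| ≤ 1 / 2 := fun j k => by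
    have := hθ j; have := hθ k
    rw [abs_le] at *; constructor <;> linarith
  -- distinct angles give distinct circle points
  have hz : ∀ j k : Fin 3, θ j ≠ θ k → cexp ((θ j : ℂ) * I) - cexp ((θ k : ℂ) * I) ≠ 0 := by
    intro j k hjk h0
    have := half_abs_sub_le_norm_cexp_sub_cexp (hd j k)
    rw [h0, norm_zero] at this
    have := abs_pos.2 (sub_ne_zero.2 hjk)
    linarith
  -- the first divided differences `q a b = i(θ_b − θ_a)∕(z_b − z_a)`
  have hq : ∀ a b : Fin 3, θ b ≠ θ a →
      (((θ b - θ a : ℝ) : ℂ) * I) / (cexp ((θ b : ℂ) * I) - cexp ((θ a : ℂ) * I)) * (cexp ((θ b : ℂ) * I) - cexp ((θ a : ℂ) * I)) =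
        (θ b : ℂ) * I - (θ a : ℂ) * I := by
    intro a b hba
    rw [div_mul_cancel₀ _ (hz b a hba)]
    push_cast
    ring
  have hqn : ∀ a b : Fin 3, θ b ≠ θ a → ‖(((θ b - θ a : ℝ) : ℂ) * I) / (cexp ((θ b : ℂ) * I) - cexp ((θ a : ℂ) * I))‖ ≤ 2 :=
    fun a b hba => norm_logDividedDiff_le hba (hd b a)
  by_cases h10 : θ 1 = θ 0
  · by_cases h20 : θ 2 = θ 0
    · -- all three angles coincide
      refine ⟨0, 0, by simp, by simp, fun k => ?_⟩
      fin_cases k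
      · simp
      · simp [h10]
      · simp [h20]
    · -- `θ₁ = θ₀ ≠ θ₂`: interpolate through `z₀, z₂` linearly
      refine ⟨(((θ 2 - θ 0 : ℝ) : ℂ) * I) / (cexp ((θ 2 : ℂ) * I) - cexp ((θ 0 : ℂ) * I)), 0, hqn 0 2 h20, by simp, fun k => ?_⟩
      fin_cases k
      · simp
      · simp [h10]
      · simp only [Fin.reduceFinMk, zero_mul, add_zero]
        rw [hq 0 2 h20]; ring
  · by_cases h20 : θ 2 = θ 0
    · -- `θ₂ = θ₀ ≠ θ₁`
      refine ⟨(((θ 1 - θ 0 : ℝ) : ℂ) * I) / (cexp ((θ 1 : ℂ) * I) - cexp ((θ 0 : ℂ) * I)), 0, hqn 0 1 h10, by simp, fun k => ?_⟩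
      fin_cases k
      · simp
      · simp only [Fin.reduceFinMk, zero_mul, add_zero]
        rw [hq 0 1 h10]; ring
      · simp [h20]
    · by_cases h21 : θ 2 = θ 1
      · -- `θ₂ = θ₁ ≠ θ₀`
        refine ⟨(((θ 1 - θ 0 : ℝ) : ℂ) * I) / (cexp ((θ 1 : ℂ) * I) - cexp ((θ 0 : ℂ) * I)), 0, hqn 0 1 h10, by simp, fun k => ?_⟩
        fin_cases k
        · simp
        · simp only [Fin.reduceFinMk, zero_mul, add_zero]
          rw [hq 0 1 h10]; ring
        · simp only [Fin.reduceFinMk, zero_mul, add_zero, h21]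
          rw [hq 0 1 h10]; ring
      · -- three distinct angles: the genuine Newton form
        have hz21 : cexp ((θ 2 : ℂ) * I) - cexp ((θ 1 : ℂ) * I) ≠ 0 := hz 2 1 h21
        refine ⟨(((θ 1 - θ 0 : ℝ) : ℂ) * I) / (cexp ((θ 1 : ℂ) * I) - cexp ((θ 0 : ℂ) * I)),
          ((((θ 2 - θ 0 : ℝ) : ℂ) * I) / (cexp ((θ 2 : ℂ) * I) - cexp ((θ 0 : ℂ) * I)) -
            (((θ 1 - θ 0 : ℝ) : ℂ) * I) / (cexp ((θ 1 : ℂ) * I) - cexp ((θ 0 : ℂ) * I))) / (cexp ((θ 2 : ℂ) * I) - cexp ((θ 1 : ℂ) * I)),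
          hqn 0 1 h10, ?_, fun k => ?_⟩
        · -- `|c₂| ≤ 4|θ₂ − θ₁| ∕ (|θ₂ − θ₁|∕2) = 8`
          have hnum := norm_logDividedDiff_sub_le h10 h20 (hd 1 0) (hd 2 0)
          have hden := half_abs_sub_le_norm_cexp_sub_cexp (hd 2 1)
          have hpos : 0 < |θ 2 - θ 1| := abs_pos.2 (sub_ne_zero.2 h21)
          rw [norm_div, div_le_iff₀ (lt_of_lt_of_le (by linarith) hden)]
          nlinarith
        · fin_cases k
          · simp
          · simp only [Fin.reduceFinMk, sub_self, mul_zero, add_zero]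
            rw [hq 0 1 h10]; ring
          · simp only [Fin.reduceFinMk]
            have key : ((((θ 2 - θ 0 : ℝ) : ℂ) * I) / (cexp ((θ 2 : ℂ) * I) - cexp ((θ 0 : ℂ) * I)) -
                (((θ 1 - θ 0 : ℝ) : ℂ) * I) / (cexp ((θ 1 : ℂ) * I) - cexp ((θ 0 : ℂ) * I))) / (cexp ((θ 2 : ℂ) * I) - cexp ((θ 1 : ℂ) * I)) *
                ((cexp ((θ 2 : ℂ) * I) - cexp ((θ 0 : ℂ) * I)) * (cexp ((θ 2 : ℂ) * I) - cexp ((θ 1 : ℂ) * I))) =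
                ((((θ 2 - θ 0 : ℝ) : ℂ) * I) / (cexp ((θ 2 : ℂ) * I) - cexp ((θ 0 : ℂ) * I)) -
                  (((θ 1 - θ 0 : ℝ) : ℂ) * I) / (cexp ((θ 1 : ℂ) * I) - cexp ((θ 0 : ℂ) * I))) * (cexp ((θ 2 : ℂ) * I) - cexp ((θ 0 : ℂ) * I)) := by
              rw [mul_comm (cexp ((θ 2 : ℂ) * I) - cexp ((θ 0 : ℂ) * I)) (cexp ((θ 2 : ℂ) * I) - cexp ((θ 1 : ℂ) * I)), ← mul_assoc,
                div_mul_cancel₀ _ hz21]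
            rw [key, sub_mul, hq 0 2 h20]
            ring

end Newton

/-! ### §3 The matrix identity `Ad(g)H = p(Ad(g)e^H)` and the bound -/

section Transfer

/-- Conjugation by `g ∈ U(2,1)` is multiplicative: `Ad(g)(AB) = Ad(g)A · Ad(g)B`. [cite: WarnerHASSLG2, §8.4.1] -/
theorem conj_mul_eq_conj_mul_conj (g : U21) (A B : Matrix (Fin 3) (Fin 3) ℂ) :
    mat g * (A * B) * mat g⁻¹ = mat g * A * mat g⁻¹ * (mat g * B * mat g⁻¹) := by
  have hgg : mat g⁻¹ * mat g = 1 := by rw [← mat_mul, inv_mul_cancel, mat_one]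
  rw [show mat g * A * mat g⁻¹ * (mat g * B * mat g⁻¹) = mat g * A * (mat g⁻¹ * mat g) * B * mat g⁻¹ by simp only [Matrix.mul_assoc],
    hgg, Matrix.mul_one]
  simp only [Matrix.mul_assoc]

/-- Conjugation fixes scalars: `Ad(g)(A − c·1) = Ad(g)A − c·1`. [cite: WarnerHASSLG2, §8.4.1] -/
theorem conj_sub_smul_one (g : U21) (A : Matrix (Fin 3) (Fin 3) ℂ) (c : ℂ) :
    mat g * (A - c • (1 : Matrix (Fin 3) (Fin 3) ℂ)) * mat g⁻¹ = mat g * A * mat g⁻¹ - c • (1 : Matrix (Fin 3) (Fin 3) ℂ) := by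
  have hgg' : mat g * mat g⁻¹ = 1 := by rw [← mat_mul, mul_inv_cancel, mat_one]
  rw [Matrix.mul_sub, Matrix.sub_mul, Matrix.mul_smul, Matrix.smul_mul, Matrix.mul_one, hgg']

/-- **`Ad(g)H = iθ₀·1 + c₁(Y − z₀) + c₂(Y − z₀)(Y − z₁)`** for `H = torusH θ`, `Y = Ad(g)·diag(e^{iθ})`, whenever `iθ_k = iθ₀ + c₁(z_k − z₀) + c₂(z_k − z₀)(z_k − z₁)` for all `k`
(simultaneous diagonalisation). [cite: WarnerHASSLG2, §8.4.1] -/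
theorem conj_torusH_eq_newton (g : U21) (θ : Fin 3 → ℝ) (c₁ c₂ : ℂ)
    (hP : ∀ k : Fin 3, (θ k : ℂ) * I = (θ 0 : ℂ) * I + c₁ * (cexp ((θ k : ℂ) * I) - cexp ((θ 0 : ℂ) * I)) +
      c₂ * ((cexp ((θ k : ℂ) * I) - cexp ((θ 0 : ℂ) * I)) * (cexp ((θ k : ℂ) * I) - cexp ((θ 1 : ℂ) * I)))) :
    mat g * torusH θ * mat g⁻¹ =
      ((θ 0 : ℂ) * I) • (1 : Matrix (Fin 3) (Fin 3) ℂ) +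
        c₁ • (mat g * Matrix.diagonal (fun k => cexp ((θ k : ℂ) * I)) * mat g⁻¹ - cexp ((θ 0 : ℂ) * I) • (1 : Matrix (Fin 3) (Fin 3) ℂ)) +
        c₂ • ((mat g * Matrix.diagonal (fun k => cexp ((θ k : ℂ) * I)) * mat g⁻¹ - cexp ((θ 0 : ℂ) * I) • (1 : Matrix (Fin 3) (Fin 3) ℂ)) *
          (mat g * Matrix.diagonal (fun k => cexp ((θ k : ℂ) * I)) * mat g⁻¹ - cexp ((θ 1 : ℂ) * I) • (1 : Matrix (Fin 3) (Fin 3) ℂ))) := by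
  have hgg' : mat g * mat g⁻¹ = 1 := by rw [← mat_mul, mul_inv_cancel, mat_one]
  set Z : Matrix (Fin 3) (Fin 3) ℂ := Matrix.diagonal (fun k => cexp ((θ k : ℂ) * I)) with hZ
  -- the torus element in Newton form, as a diagonal matrix
  have htorus : torusH θ = ((θ 0 : ℂ) * I) • (1 : Matrix (Fin 3) (Fin 3) ℂ) + c₁ • (Z - cexp ((θ 0 : ℂ) * I) • (1 : Matrix (Fin 3) (Fin 3) ℂ)) +
      c₂ • ((Z - cexp ((θ 0 : ℂ) * I) • (1 : Matrix (Fin 3) (Fin 3) ℂ)) * (Z - cexp ((θ 1 : ℂ) * I) • (1 : Matrix (Fin 3) (Fin 3) ℂ))) := by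
    rw [torusH, hZ, smul_one_eq_diagonal, smul_one_eq_diagonal, smul_one_eq_diagonal, diagonal_sub, diagonal_sub, diagonal_mul_diagonal,
      ← diagonal_smul, ← diagonal_smul, diagonal_add, diagonal_add]
    congr 1
    funext k
    simp only [Pi.smul_apply, smul_eq_mul]
    exact hP k
  rw [htorus, Matrix.mul_add, Matrix.mul_add, Matrix.add_mul, Matrix.add_mul, Matrix.mul_smul, Matrix.mul_smul, Matrix.mul_smul,
    Matrix.smul_mul, Matrix.smul_mul, Matrix.smul_mul, Matrix.mul_one, hgg', conj_mul_eq_conj_mul_conj, conj_sub_smul_one, conj_sub_smul_one]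

/-- **THE TRANSFER BOUND `‖Ad(g)·e^{H}‖ ≤ R ⟹ ‖Ad(g)·H‖ ≤ 1∕4 + 2(R+1) + 8(R+1)²`** for `H = torusH θ`, `|θ_k| ≤ 1∕4` (`L^∞` operator norm; `e^{H} = diag(e^{iθ_k})`).
[cite: WarnerHASSLG2, §8.4.1] -/
theorem norm_conj_torusH_le_of_norm_conj_exp_le (g : U21) (θ : Fin 3 → ℝ) (hθ : ∀ k, |θ k| ≤ 1 / 4) {R : ℝ}
    (hR : ‖mat g * Matrix.diagonal (fun k => cexp ((θ k : ℂ) * I)) * mat g⁻¹‖ ≤ R) :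
    ‖mat g * torusH θ * mat g⁻¹‖ ≤ 1 / 4 + 2 * (R + 1) + 8 * (R + 1) ^ 2 := by
  obtain ⟨c₁, c₂, hc₁, hc₂, hP⟩ := exists_newton_coeffs θ hθ
  rw [conj_torusH_eq_newton g θ c₁ c₂ hP]
  set Y : Matrix (Fin 3) (Fin 3) ℂ := mat g * Matrix.diagonal (fun k => cexp ((θ k : ℂ) * I)) * mat g⁻¹ with hY
  have hR0 : 0 ≤ R := (norm_nonneg _).trans hR
  have hone : ‖(1 : Matrix (Fin 3) (Fin 3) ℂ)‖ = 1 := norm_one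
  have hshift : ∀ j : Fin 3, ‖Y - cexp ((θ j : ℂ) * I) • (1 : Matrix (Fin 3) (Fin 3) ℂ)‖ ≤ R + 1 := fun j =>
    (norm_sub_le _ _).trans (by rw [norm_smul, Complex.norm_exp_ofReal_mul_I, hone, one_mul]; linarith)
  have h0 : ‖((θ 0 : ℂ) * I) • (1 : Matrix (Fin 3) (Fin 3) ℂ)‖ ≤ 1 / 4 := by
    rw [norm_smul, norm_mul, Complex.norm_I, mul_one, Complex.norm_real, Real.norm_eq_abs, hone, mul_one]
    exact hθ 0
  have h1 : ‖c₁ • (Y - cexp ((θ 0 : ℂ) * I) • (1 : Matrix (Fin 3) (Fin 3) ℂ))‖ ≤ 2 * (R + 1) := by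
    rw [norm_smul]
    exact mul_le_mul hc₁ (hshift 0) (norm_nonneg _) (by norm_num)
  have h2 : ‖c₂ • ((Y - cexp ((θ 0 : ℂ) * I) • (1 : Matrix (Fin 3) (Fin 3) ℂ)) * (Y - cexp ((θ 1 : ℂ) * I) • (1 : Matrix (Fin 3) (Fin 3) ℂ)))‖ ≤
      8 * (R + 1) ^ 2 := by
    rw [norm_smul]
    refine mul_le_mul hc₂ ((norm_mul_le _ _).trans ?_) (norm_nonneg _) (by norm_num)
    rw [sq]
    exact mul_le_mul (hshift 0) (hshift 1) (norm_nonneg _) (by linarith)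
  exact (norm_add₃_le).trans (by linarith)

/-- The same bound for the group element `ζ·diag(e^{iθ})` of the socket chart (`|ζ| = 1` is absorbed). [cite: WarnerHASSLG2, §8.4.1] -/
theorem norm_conj_torusH_le_of_norm_conj_circle_exp_le (g : U21) (θ : Fin 3 → ℝ) (hθ : ∀ k, |θ k| ≤ 1 / 4) (ζ : Circle) {R : ℝ}
    (hR : ‖mat g * Matrix.diagonal (fun k => ((ζ * Circle.exp (θ k) : Circle) : ℂ)) * mat g⁻¹‖ ≤ R) :
    ‖mat g * torusH θ * mat g⁻¹‖ ≤ 1 / 4 + 2 * (R + 1) + 8 * (R + 1) ^ 2 := by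
  refine norm_conj_torusH_le_of_norm_conj_exp_le g θ hθ ?_
  have hfun : (fun k => ((ζ * Circle.exp (θ k) : Circle) : ℂ)) = (ζ : ℂ) • fun k => cexp ((θ k : ℂ) * I) := by
    funext k
    simp [Circle.coe_exp]
  have hdiag : Matrix.diagonal (fun k => ((ζ * Circle.exp (θ k) : Circle) : ℂ)) = (ζ : ℂ) • Matrix.diagonal (fun k => cexp ((θ k : ℂ) * I)) := by
    rw [hfun, diagonal_smul]
  rw [hdiag, Matrix.mul_smul, Matrix.smul_mul, norm_smul, Circle.norm_coe, one_mul] at hR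
  exact hR

end Transfer

end BallModel

end Literature.Geometry.ComplexHyperbolic

end
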